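import Summits.ResolutionOfSingularities.ResolutionOfSingularities.Theorems.MaxContactCutSatelliteCut
import Summits.ResolutionOfSingularities.ResolutionOfSingularities.Theorems.HistoryCutCells
import HarnessLib

/-!
# MaxContactCutHistoryCut — decomp-res node «HistoryCut» (lens-4 g29, critic row 169), tree file 4/4 of the node

Content VERBATIM from the decomp-res lens-4 g29 node `HOME/decomp-res-lens-4/g29/HistoryCut.lean` (pin aaa5a818),
NEW PART §78–§80 = `parts/part_new-g29-0eb23edf.lean`;
HOME = run/shared/lean/pub/decomp-res; critic row 169 CLEARED +1; landing orders INBOX :708 / :721 — provenance,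
critic text and the lens header in full in the
first file of the node, `HistoryTransport`.  Namespace `…Theorems.HugValuationCut`; `--supports
stmt-ResolutionOfSingularities-28338`.

## This file

THE FOUR §80 COROLLARIES GIVEN 31571 `MaxContactCut.NoContactHuggingTowers` BY NAME (in the Theses cone):
`noWildKangarooOffDoublePointTowers_iff_g29 (h71)` · `noWildKangarooOffLocusTowers_iff_g29 (h71)` ·
`noWildPPowerOffLocusTowers_iff_g29 (h71)` · `noWildContactFreeOffLocusTowers_iff_g29 (h71)` — TREE ASIDE 28338 /
the g25–g28 residuals ⟺ the g29 located residual (the old-component cell being decided), through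
`MaxContactCutSatelliteCut`'s `…_iff_g28 (h71)` family and the hypothesis-free
`noWildFreeJumpShallowCompanionKangarooTowers_iff_g29`.  Imports `MaxContactCutSatelliteCut` + `HistoryCutCells`; 0 sorry.

[WRITER NOTE (decomp-res writer g10): file split only (tree files ≤ 400 lines); namespace, universes, sections,
section variables and every declaration
exactly as in the lens (the node's global dupNamespace-linter line is dropped — the library sets it; the `open
…Theses` line lives only in the wiring file;
`set_option maxHeartbeats … in` prefixes of single declarations are kept).]

(Sources: Hauser2010Kangaroo (arXiv:0811.4151 p. 6, Kangaroo Theorem condition (3) + remark (a)); HauserPerlega2019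
§2; Hauser2024 PRIMS 60; Moh1987; Matsumura1987 Thms. 14.2–14.3; ZariskiSamuel1960 VIII §11; StacksProject Tags
0804, 0BIQ, 00NQ; DeJong1996 2.4; CossartPiltant2008 §2; Giraud1975.)
-/

noncomputable section

open CategoryTheory AlgebraicGeometry IsLocalRing
open Literature.AlgebraicGeometry.Resolution
open Summit.ResolutionOfSingularities.ResolutionOfSingularities.Theses
open Summit.ResolutionOfSingularities.ResolutionOfSingularities.Theorems
open WeakOrderReduction ForcedTowerClasses DivergentTowerClasses MonomialTowerClasses
open HugDimensionClasses HugDimensionKernels SurfaceShadowClasses SurfaceShadowKernels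
open NearPointCut (SingularClass)
open AbsoluteContactClasses (IsAbsContactAt SepResidueAt diffIdeal_restrict_le stalkMap_comp_toStalk_eq_stalkHom)
open scoped BigOperators

namespace Summit.ResolutionOfSingularities.ResolutionOfSingularities.Theorems.HugValuationCut

section HistoryCells

/-- **GIVEN 31571 BY NAME: the g25 residual ⟺ the fresh-jump residual.** [folklore] -/
theorem noWildKangarooOffDoublePointTowers_iff_g29 (h71 : MaxContactCut.NoContactHuggingTowers) :
    NoWildKangarooOffDoublePointTowers ↔ NoWildFreshJumpShallowCompanionKangarooTowers := by
  rw [noWildKangarooOffDoublePointTowers_iff_g28 h71, noWildFreeJumpShallowCompanionKangarooTowers_iff_g29]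

/-- **GIVEN 31571 BY NAME: g24's kangaroo residual ⟺ the fresh-jump residual.** [folklore] -/
theorem noWildKangarooOffLocusTowers_iff_g29 (h71 : MaxContactCut.NoContactHuggingTowers) :
    NoWildKangarooOffLocusTowers ↔ NoWildFreshJumpShallowCompanionKangarooTowers := by
  rw [noWildKangarooOffLocusTowers_iff_g28 h71, noWildFreeJumpShallowCompanionKangarooTowers_iff_g29]

/-- **GIVEN 31571 BY NAME: g23's `p`-power residual ⟺ the fresh-jump residual.** [folklore] -/
theorem noWildPPowerOffLocusTowers_iff_g29 (h71 : MaxContactCut.NoContactHuggingTowers) :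
    NoWildPPowerOffLocusTowers ↔ NoWildFreshJumpShallowCompanionKangarooTowers := by
  rw [noWildPPowerOffLocusTowers_iff_g28 h71, noWildFreeJumpShallowCompanionKangarooTowers_iff_g29]

/-- **GIVEN 31571 BY NAME, THE TREE ASIDE 28338 ⟺ THE g29 RESIDUAL** — `NoWildContactFreeOffLocusTowers` ⟺ the fresh-jump
shallow companion-recurrent residual. [folklore] -/
theorem noWildContactFreeOffLocusTowers_iff_g29 (h71 : MaxContactCut.NoContactHuggingTowers) :
    NoWildContactFreeOffLocusTowers ↔ NoWildFreshJumpShallowCompanionKangarooTowers := by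
  rw [noWildContactFreeOffLocusTowers_iff_g28 h71, noWildFreeJumpShallowCompanionKangarooTowers_iff_g29]

end HistoryCells

end Summit.ResolutionOfSingularities.ResolutionOfSingularities.Theorems.HugValuationCut
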